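import Literature.MathematicalPhysics.PowerSystems.KuramotoCutsetStabilityNecessity
import Literature.MathematicalPhysics.PowerSystems.NormalOperationStability
import HarnessLib

/-!
# Taylor's Theorem 4.1: the homogeneous Kuramoto model on the COMPLETE network has NO non-zero
# stable fixed point — in the print's own first-order model with the print's notion of stability,
# with Lyapunov stability (an «iff»), and its damped second-order (swing) twin

Topic `Literature/MathematicalPhysics/PowerSystems`, namespaces
`Literature.MathematicalPhysics.PowerSystems.{NonuniformKuramoto, ClassicalModel.LosslessSystem}`.
The tree's ring files show MULTISTABILITY on sparse (single-loop) networks (`2⌈N/4⌉ − 1` stable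
synchronous states of the homogeneous ring: `ClassicalModel.ring_normalOperation_census`,
`NonuniformKuramoto.ring_lockedSolution_stable_iff_twisted`). This file types the opposite end, as
printed: on the COMPLETE (all-to-all, uniformly coupled) network with identical natural frequencies
the in-phase state is the ONLY stable phase-locked state — R. Taylor's Theorem 4.1 («Any complete
network homogeneous Kuramoto model has no non-zero stable fixed point»), which «proves a conjecture
of Verwoerd and Mason (2007)». Following the printed proof (order parameter `p = Σⱼe^{iθⱼ}`; the
case `p ≠ 0` splits the nodes into two antipodal classes coupled with cosine `−1`, so Lemma 2.1
empties one class; the case `p = 0` makes every single-node cut equal to `−1`), written in real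
coordinates `p = a + ib`. Everything is PROVED; no definition, no named fact, no axiom.

SOURCES (read on the page this session). R. Taylor, *There is no non-zero stable fixed point for
dense networks in the homogeneous Kuramoto model*, J. Phys. A 45 (2012) 055102 [TaylorKuramoto2012]
(`lit read arxiv:1109.4451`; the held text lacks the display equations, whose content is read
from the surrounding prose and from DCJ's restatement): §1.1 model (1.1) (phases `θᵢ`, natural
frequencies `ωᵢ`, one coupling constant `k`, network adjacency `Aᵢⱼ`; p0003), §2
stability := «all the eigenvalues of the matrix M are less than or equal to zero» (p0007 L15) and
Lemma 2.1 (p0008), §3 «in the homogeneous case it is sufficient to consider the case where the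
natural frequencies are all zero … From herein we make this assumption» (p0009), §4.1 **Theorem 4.1**
«Any complete network homogeneous Kuramoto model has no non-zero stable fixed point» with its proof
(p0011–p0012: `zⱼ = e^{iθ*ⱼ}`, `p = Σzⱼ`; «Case p ≠ 0 … θ* are divided between θ_p and θ_p + π …
non-empty node sets A and Aᶜ … This is unstable by inequality (2.4). Case p = 0 … unstable by
equation (2.3)»), «It is well known that the zero fixed point is stable» (p0011), Corollary 4.1
(basin, NOT typed). R. Delabays, T. Coletta, P. Jacquod, J. Math. Phys. 57 (2016) 032701
[DelabaysColettaJacquod2016] §2.2 (stability matrix, arXiv:1512.04266 p0005–p0006). D. Manik,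
M. Timme, D. Witthaut, Chaos 27 (2017) 083123 [ManikTimmeWitthaut2017] §3 Lemma 1 / Cor. 1 (both
model tiers). H. K. Khalil [Khalil2002] Thm 4.7, through gridfusion-lit-2's typed clauses.

## What is proved

* §0 (model-free core) `cut_singleton`, ★★ **`cos_sub_eq_one_of_sum_sin_eq_zero_of_cuts_nonneg`**:
  phases with `Σⱼ sin(θₘ − θⱼ) = 0` for all `m` and all complete-graph cuts `Σ_{i∈S,j∉S}cos(θᵢ −
  θⱼ) ≥ 0` have `cos(θᵢ − θⱼ) = 1` for all `i, j` (Taylor's proof, real coordinates).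
* §1 FIRST-ORDER MODEL (`Kur : NonuniformKuramoto n`, complete uniform coupling `Pᵢⱼ = k` (`i ≠ j`),
  `Pᵢᵢ = 0`, `k > 0`, `φ = 0`, any `Dᵢ > 0`, homogeneous natural frequencies `ωᵢ = Dᵢc` — for
  the print's `Dᵢ = 1`: `ωᵢ ≡ c`): `complete_cut_eq`, `complete_syncFreq_eq`,
  `complete_sum_sin_eq_zero_of_locked`, ★★★ **`complete_cos_eq_one_of_stabilityMatrix_negSemidef`**
  (THEOREM 4.1 VERBATIM: a phase-locked state whose stability matrix `M = −L(θ)` is negative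
  semidefinite has all phase differences `≡ 0 (mod 2π)`), `complete_exists_int_of_stabilityMatrix_negSemidef`
  (the same as `θⱼ = θᵢ + 2πmⱼ`), ★★ **`complete_cos_eq_one_of_lockedSolution_stable`** (the same
  with «stable» = Lyapunov stability of the locked solution), `complete_couplingConnected`,
  `lockedSolution_stable_of_locally_expStable` (generic: exponential stability modulo rotation ⇒
  Lyapunov stability of the locked solution), ★★★ **`complete_lockedSolution_stable_iff_inPhase`**
  (a phase-locked state of the complete homogeneous model is Lyapunov stable IFF it is the in-phase
  state modulo `2π`; «It is well known that the zero fixed point is stable» ⇐ MTW Cor. 1, lit-2), and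
  `classic_lockedSolution_stable_iff_inPhase` (the tree's `classic n K ω` all-to-all Kuramoto model
  with `ωᵢ ≡ ω₀`, `K > 0`).
* §2 SWING TWIN (`S : ClassicalModel.LosslessSystem n 0`, `Cᵢⱼ = k` (`i ≠ j`), `k > 0`, unloaded
  `P = 0`, `Mᵢ, Dᵢ > 0`): ★★ **`complete_cos_eq_one_of_stable`** (a synchronous state `flow(θ) = 0`
  whose rest point `(θ, 0)` is Lyapunov stable is in phase), ★★★ **`complete_stable_iff_inPhase`**
  (Lyapunov stable with existence of motions ⇔ in phase; ⇐ by `stable_syncSolution_of_normalOperation`).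

THREE COLUMNS. CERTIFIED for MODEL `M_K` = first-order Kuramoto model on the complete network with
one coupling constant and identical (specific) natural frequencies, any `Dᵢ > 0`, and for MODEL
`M_S` = damped lossless swing model with complete uniform coupling and zero injections: the in-phase
state is the unique stable phase-locked / synchronous state (both the print's notion and Lyapunov's).
NOT CLAIMED: Taylor's dense-network Theorem 4.2 (`δ ≥ 0.9395(n−1)`), Corollary 4.1 (almost-global
basin), non-uniform weights or non-identical frequencies; anything about a grid (a Kron-reduced
network is complete but neither uniformly coupled nor unloaded — MODELLED gap stated, not bridged).
-/

noncomputable section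

open Real Set Filter Topology Metric Finset
open scoped Matrix

namespace Literature.MathematicalPhysics.PowerSystems

/-! ### §0. The geometric core of Theorem 4.1 (model-free) -/

section Core

variable {n : ℕ}

/-- The single-node cut of the complete graph: `Σ_{j ≠ m} cos(θₘ − θⱼ) = Σⱼ cos(θₘ − θⱼ) − 1`
(«Case p = 0 … unstable by equation (2.3)»: the diagonal entry of `M`).
[cite: TaylorKuramoto2012, §4.1 proof of Theorem 4.1, case p = 0 (arXiv:1109.4451 p0012)] -/
theorem cut_singleton (θ : Fin n → ℝ) (m : Fin n) :
    ∑ i ∈ ({m} : Finset (Fin n)), ∑ j ∈ ({m} : Finset (Fin n))ᶜ, Real.cos (θ i - θ j)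
      = (∑ j, Real.cos (θ m - θ j)) - 1 := by
  rw [Finset.sum_singleton]
  have h := Finset.sum_add_sum_compl ({m} : Finset (Fin n)) (fun j => Real.cos (θ m - θ j))
  rw [Finset.sum_singleton, sub_self, Real.cos_zero] at h
  linarith

/-- **The geometric core of Taylor's Theorem 4.1** (model-free): if the phases `θ₁ … θₙ` satisfy the
homogeneous fixed-point equations `Σⱼ sin(θₘ − θⱼ) = 0` for every `m` and every cut of the complete
graph is non-negative, `Σ_{i∈S} Σ_{j∉S} cos(θᵢ − θⱼ) ≥ 0` for every node set `S`, then all phases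
agree modulo `2π`: `cos(θᵢ − θⱼ) = 1` for all `i, j`. (Taylor's proof with the order parameter
`p = Σⱼ e^{iθⱼ} = a + ib`: if `p = 0` every single-node cut equals `−1`; if `p ≠ 0` every `θₘ` is
`arg p` modulo `π`, the two classes are coupled with cosine `−1`, so one class is empty.)
[cite: TaylorKuramoto2012, §4.1 Theorem 4.1 and its proof (arXiv:1109.4451 p0011–p0012)] -/
theorem cos_sub_eq_one_of_sum_sin_eq_zero_of_cuts_nonneg (θ : Fin n → ℝ)
    (hfix : ∀ m, ∑ j, Real.sin (θ m - θ j) = 0)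
    (hcut : ∀ S : Finset (Fin n), 0 ≤ ∑ i ∈ S, ∑ j ∈ Sᶜ, Real.cos (θ i - θ j)) (i j : Fin n) :
    Real.cos (θ i - θ j) = 1 := by
  -- the order parameter `p = a + ib`
  set a : ℝ := ∑ l, Real.cos (θ l) with ha
  set b : ℝ := ∑ l, Real.sin (θ l) with hb
  -- `c m = Σⱼ cos(θₘ − θⱼ) = a cos θₘ + b sin θₘ`, and the fixed-point equations say `a sin θₘ = b cos θₘ`
  set c : Fin n → ℝ := fun m => ∑ l, Real.cos (θ m - θ l) with hc
  have hcm : ∀ m, c m = a * Real.cos (θ m) + b * Real.sin (θ m) := by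
    intro m
    simp only [hc, ha, hb, Real.cos_sub, Finset.sum_add_distrib, Finset.sum_mul]
    refine congrArg₂ (· + ·) (Finset.sum_congr rfl fun l _ => by ring)
      (Finset.sum_congr rfl fun l _ => by ring)
  have hsm : ∀ m, a * Real.sin (θ m) = b * Real.cos (θ m) := by
    intro m
    have h := hfix m
    simp only [Real.sin_sub, Finset.sum_sub_distrib] at h
    have e1 : ∑ l, Real.sin (θ m) * Real.cos (θ l) = a * Real.sin (θ m) := by
      rw [ha, Finset.sum_mul]; exact Finset.sum_congr rfl fun l _ => by ring
    have e2 : ∑ l, Real.cos (θ m) * Real.sin (θ l) = b * Real.cos (θ m) := by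
      rw [hb, Finset.sum_mul]; exact Finset.sum_congr rfl fun l _ => by ring
    linarith
  -- the single-node cut at `m` is `c m − 1`
  have hsingle : ∀ m, 0 ≤ c m - 1 := by
    intro m
    have h := hcut {m}
    rwa [cut_singleton] at h
  by_cases hab : a = 0 ∧ b = 0
  · -- `p = 0`: every `c m` vanishes, contradicting the single-node cut at `i`
    exfalso
    have h0 : c i = 0 := by rw [hcm, hab.1, hab.2]; ring
    have := hsingle i
    linarith
  · -- `p ≠ 0`
    have hr : 0 < a ^ 2 + b ^ 2 := by
      rcases not_and_or.1 hab with h | h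
      · have := sq_pos_of_ne_zero h; positivity
      · have := sq_pos_of_ne_zero h; positivity
    set r2 : ℝ := a ^ 2 + b ^ 2 with hr2
    -- `c m² = r2`, `cos θₘ = a c m / r2`, `sin θₘ = b c m / r2`
    have hsq : ∀ m, c m ^ 2 = r2 := by
      intro m
      have e : (a * Real.cos (θ m) + b * Real.sin (θ m)) ^ 2
          + (a * Real.sin (θ m) - b * Real.cos (θ m)) ^ 2
          = (a ^ 2 + b ^ 2) * (Real.sin (θ m) ^ 2 + Real.cos (θ m) ^ 2) := by ring
      rw [Real.sin_sq_add_cos_sq, mul_one, ← hcm, hsm m, sub_self] at e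
      rw [hr2, ← e]; ring
    have hcos : ∀ m, r2 * Real.cos (θ m) = a * c m := by
      intro m
      rw [hcm, hr2]
      linear_combination (-b) * hsm m
    have hsin : ∀ m, r2 * Real.sin (θ m) = b * c m := by
      intro m
      rw [hcm, hr2]
      linear_combination a * hsm m
    have hcosij : ∀ l m, r2 * Real.cos (θ l - θ m) = c l * c m := by
      intro l m
      have e : r2 * (r2 * Real.cos (θ l - θ m))
          = (r2 * Real.cos (θ l)) * (r2 * Real.cos (θ m))
            + (r2 * Real.sin (θ l)) * (r2 * Real.sin (θ m)) := by
        rw [Real.cos_sub]; ring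
      rw [hcos, hcos, hsin, hsin] at e
      have e2 : a * c l * (a * c m) + b * c l * (b * c m) = r2 * (c l * c m) := by
        rw [hr2]; ring
      rw [e2] at e
      exact mul_left_cancel₀ hr.ne' e
    -- the class of `i`: nodes with `c m = c i`; across the class boundary the cosine is `−1`
    set A : Finset (Fin n) := Finset.univ.filter (fun m => c m = c i) with hAdef
    have hA : ∀ m, m ∈ A ↔ c m = c i := fun m => by rw [hAdef, Finset.mem_filter]; simp
    have hopp : ∀ m, m ∉ A → c m = -c i := by
      intro m hm
      rw [hA] at hm
      have h1 : c m ^ 2 = c i ^ 2 := by rw [hsq, hsq]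
      have h2 : (c m - c i) * (c m + c i) = 0 := by nlinarith [h1]
      rcases mul_eq_zero.1 h2 with h | h
      · exact absurd (sub_eq_zero.1 h) hm
      · linarith
    have hneg1 : ∀ l ∈ A, ∀ m ∈ Aᶜ, Real.cos (θ l - θ m) = -1 := by
      intro l hl m hm
      rw [Finset.mem_compl] at hm
      have e := hcosij l m
      rw [(hA l).1 hl, hopp m hm] at e
      have e2 : r2 * Real.cos (θ l - θ m) = r2 * (-1) := by
        rw [e, ← hsq i]; ring
      exact mul_left_cancel₀ hr.ne' e2
    -- if the other class were non-empty the cut of `A` would be `−|A|·|Aᶜ| < 0`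
    have hAc : Aᶜ = ∅ := by
      by_contra hne
      obtain ⟨m, hm⟩ := Finset.nonempty_iff_ne_empty.2 hne
      have hiA : i ∈ A := (hA i).2 rfl
      have hcutA := hcut A
      have e : ∑ l ∈ A, ∑ m ∈ Aᶜ, Real.cos (θ l - θ m) = ∑ l ∈ A, ∑ m ∈ Aᶜ, (-1 : ℝ) :=
        Finset.sum_congr rfl fun l hl => Finset.sum_congr rfl fun m hm => hneg1 l hl m hm
      rw [e] at hcutA
      simp only [Finset.sum_const, nsmul_eq_mul] at hcutA
      have h1 : (0 : ℝ) < A.card := by exact_mod_cast Finset.card_pos.2 ⟨i, hiA⟩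
      have h2 : (0 : ℝ) < Aᶜ.card := by exact_mod_cast Finset.card_pos.2 ⟨m, hm⟩
      nlinarith [mul_pos h1 h2]
    -- hence `c j = c i` and `cos(θᵢ − θⱼ) = c i c j / r2 = 1`
    have hj : j ∈ A := by
      by_contra h
      have : j ∈ Aᶜ := Finset.mem_compl.2 h
      rw [hAc] at this
      exact Finset.notMem_empty j this
    have e := hcosij i j
    rw [(hA j).1 hj, ← sq, hsq] at e
    have e2 : r2 * Real.cos (θ i - θ j) = r2 * 1 := by rw [e, mul_one]
    exact mul_left_cancel₀ hr.ne' e2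


end Core

/-! ### §1. Theorem 4.1 in the first-order Kuramoto model -/

namespace NonuniformKuramoto

variable {n : ℕ} (Kur : NonuniformKuramoto n) (k c : ℝ)

/-- On the complete uniformly coupled network a cut weighs `k` per pair:
`Σ_{i∈S}Σ_{j∉S} Pᵢⱼcos(θᵢ − θⱼ) = k·Σ_{i∈S}Σ_{j∉S} cos(θᵢ − θⱼ)`.
[cite: TaylorKuramoto2012, §2 inequality (2.4) on the complete network (§4.1)] -/
theorem complete_cut_eq (hP : ∀ i j, Kur.P i j = if i = j then 0 else k) (θ : Fin n → ℝ)
    (S : Finset (Fin n)) :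
    ∑ i ∈ S, ∑ j ∈ Sᶜ, Kur.P i j * Real.cos (θ i - θ j)
      = k * ∑ i ∈ S, ∑ j ∈ Sᶜ, Real.cos (θ i - θ j) := by
  rw [Finset.mul_sum]
  refine Finset.sum_congr rfl fun i hi => ?_
  rw [Finset.mul_sum]
  refine Finset.sum_congr rfl fun j hj => ?_
  have hij : i ≠ j := fun h => (Finset.mem_compl.1 hj) (h ▸ hi)
  rw [hP, if_neg hij]

/-- Homogeneous (specific) natural frequencies `ωᵢ = Dᵢc` give the synchronous frequency `c`
(for the print's `Dᵢ = 1`: identical `ωᵢ ≡ c`). [cite: TaylorKuramoto2012, §1.1 eq. (1.2) and §3 (arXiv:1109.4451 p0003, p0009)] -/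
theorem complete_syncFreq_eq (hD : ∀ i, 0 < Kur.D i) (hω : ∀ i, Kur.ω i = Kur.D i * c)
    (hn : 0 < n) : (∑ j, Kur.ω j) / ∑ j, Kur.D j = c := by
  have hDs : 0 < ∑ j, Kur.D j := by
    haveI : Nonempty (Fin n) := ⟨⟨0, hn⟩⟩
    exact Finset.sum_pos (fun i _ => hD i) Finset.univ_nonempty
  rw [div_eq_iff hDs.ne', Finset.mul_sum]
  exact Finset.sum_congr rfl fun j _ => by rw [hω j, mul_comm]

/-- **The homogeneous fixed-point equations**: a phase-locked state of the complete homogeneous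
model satisfies `Σⱼ sin(θₘ − θⱼ) = 0` at every node (equation (3.2), «sufficient to consider the
case where the natural frequencies are all zero»).
[cite: TaylorKuramoto2012, §3 eq. (3.2) (arXiv:1109.4451 p0009)] -/
theorem complete_sum_sin_eq_zero_of_locked (hD : ∀ i, 0 < Kur.D i) (hk : k ≠ 0)
    (hP : ∀ i j, Kur.P i j = if i = j then 0 else k) (hω : ∀ i, Kur.ω i = Kur.D i * c)
    (hφ : ∀ i j, Kur.φ i j = 0) {θ : Fin n → ℝ}
    (hθ : ∀ i, Kur.field θ i = (∑ j, Kur.ω j) / ∑ j, Kur.D j) (m : Fin n) :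
    ∑ j, Real.sin (θ m - θ j) = 0 := by
  have hn : 0 < n := Fin.pos m
  have h := hθ m
  rw [Kur.complete_syncFreq_eq c hD hω hn] at h
  unfold field at h
  rw [div_eq_iff (hD m).ne', hω m] at h
  have hsum : ∑ j, Kur.P m j * Real.sin (θ m - θ j + Kur.φ m j) = k * ∑ j, Real.sin (θ m - θ j) := by
    rw [Finset.mul_sum]
    refine Finset.sum_congr rfl fun j _ => ?_
    rw [hφ, add_zero, hP]
    by_cases hmj : m = j
    · subst hmj; simp
    · rw [if_neg hmj]
  rw [hsum] at h
  have h2 : k * ∑ j, Real.sin (θ m - θ j) = 0 := by linarith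
  rcases mul_eq_zero.1 h2 with h3 | h3
  · exact absurd h3 hk
  · exact h3

/-- ★★★ **TAYLOR'S THEOREM 4.1, VERBATIM (first-order model, print's notion of stability).** In the
homogeneous Kuramoto model on the complete network (`Pᵢⱼ = k > 0` for `i ≠ j`, `φ = 0`, `ωᵢ = Dᵢc`,
any `Dᵢ > 0`), a phase-locked state `θ` whose stability matrix `M(θ) = −L(θ)` is negative
semidefinite («stable» as printed) is the in-phase state: `cos(θᵢ − θⱼ) = 1` for all `i, j` — «Any
complete network homogeneous Kuramoto model has no non-zero stable fixed point».
[cite: TaylorKuramoto2012, §4.1 Theorem 4.1 with proof (arXiv:1109.4451 p0011–p0012); §2 Lemma 2.1] -/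
theorem complete_cos_eq_one_of_stabilityMatrix_negSemidef (hD : ∀ i, 0 < Kur.D i) (hk : 0 < k)
    (hP : ∀ i j, Kur.P i j = if i = j then 0 else k) (hω : ∀ i, Kur.ω i = Kur.D i * c)
    (hφ : ∀ i j, Kur.φ i j = 0) {θ : Fin n → ℝ}
    (hθ : ∀ i, Kur.field θ i = (∑ j, Kur.ω j) / ∑ j, Kur.D j)
    (hst : ∀ z : Fin n → ℝ, z ⬝ᵥ ((-Kur.toDroopNetwork.lap θ) *ᵥ z) ≤ 0) (i j : Fin n) :
    Real.cos (θ i - θ j) = 1 := by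
  refine cos_sub_eq_one_of_sum_sin_eq_zero_of_cuts_nonneg θ
    (Kur.complete_sum_sin_eq_zero_of_locked k c hD hk.ne' hP hω hφ hθ) (fun S => ?_) i j
  have h := Kur.cut_nonneg_of_stabilityMatrix_negSemidef hst S
  rw [Kur.complete_cut_eq k hP θ S] at h
  exact (mul_nonneg_iff_of_pos_left hk).1 h

/-- **… i.e. every phase is the reference phase plus a whole number of turns**: `θⱼ = θᵢ + 2πmⱼ`
(«no non-zero fixed point»: all phase differences vanish modulo `2π`).
[cite: TaylorKuramoto2012, §4.1 Theorem 4.1 (arXiv:1109.4451 p0011); §1.2 («zero fixed point», p0005)] -/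
theorem complete_exists_int_of_stabilityMatrix_negSemidef (hD : ∀ i, 0 < Kur.D i) (hk : 0 < k)
    (hP : ∀ i j, Kur.P i j = if i = j then 0 else k) (hω : ∀ i, Kur.ω i = Kur.D i * c)
    (hφ : ∀ i j, Kur.φ i j = 0) {θ : Fin n → ℝ}
    (hθ : ∀ i, Kur.field θ i = (∑ j, Kur.ω j) / ∑ j, Kur.D j)
    (hst : ∀ z : Fin n → ℝ, z ⬝ᵥ ((-Kur.toDroopNetwork.lap θ) *ᵥ z) ≤ 0) (i j : Fin n) :
    ∃ mj : ℤ, θ j = θ i + mj * (2 * π) := by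
  have h := Kur.complete_cos_eq_one_of_stabilityMatrix_negSemidef k c hD hk hP hω hφ hθ hst j i
  obtain ⟨mj, hmj⟩ := (Real.cos_eq_one_iff _).1 h
  exact ⟨mj, by linarith⟩

/-- ★★ **THEOREM 4.1 WITH «STABLE» = LYAPUNOV STABLE** (first-order model, `Dᵢ > 0`): if the locked
solution `t ↦ θ + ω_sync t𝟙` through a phase-locked state `θ` of the complete homogeneous model is
Lyapunov stable (every motion from every `δ`-close phase vector stays in the `ε`-tube; motions exist,
`exists_globalSolution`), then `θ` is the in-phase state: `cos(θᵢ − θⱼ) = 1` for all `i, j` (the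
stability matrix of a Lyapunov-stable locked solution is negative semidefinite,
`stabilityMatrix_negSemidef_of_lockedSolution_stable`).
[cite: TaylorKuramoto2012, §4.1 Theorem 4.1 (arXiv:1109.4451 p0011–p0012); ManikTimmeWitthaut2017, §3 Lemma 1; Khalil2002, Theorem 4.7 (part 2)] -/
theorem complete_cos_eq_one_of_lockedSolution_stable (hD : ∀ i, 0 < Kur.D i) (hk : 0 < k)
    (hP : ∀ i j, Kur.P i j = if i = j then 0 else k) (hω : ∀ i, Kur.ω i = Kur.D i * c)
    (hφ : ∀ i j, Kur.φ i j = 0) {θu : Fin n → ℝ}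
    (hθu : ∀ i, Kur.field θu i = (∑ j, Kur.ω j) / ∑ j, Kur.D j)
    (hst : ∀ ε > 0, ∃ δ > 0, ∀ x₁ : Fin n → ℝ, ‖x₁ - θu‖ < δ → ∀ θ : ℝ → Fin n → ℝ,
      θ 0 = x₁ → (∀ T : ℝ, ∀ t ∈ Icc 0 T, HasDerivWithinAt θ (Kur.field (θ t)) (Icc 0 T) t) →
      ∀ t, 0 ≤ t → ‖θ t - fun i => θu i + (∑ j, Kur.ω j) / (∑ j, Kur.D j) * t‖ < ε)
    (i j : Fin n) : Real.cos (θu i - θu j) = 1 := by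
  have hPs : ∀ i j, Kur.P i j = Kur.P j i := by
    intro i j
    rw [hP, hP]
    by_cases h : i = j
    · subst h; rfl
    · rw [if_neg h, if_neg (Ne.symm h)]
  exact Kur.complete_cos_eq_one_of_stabilityMatrix_negSemidef k c hD hk hP hω hφ hθu
    (Kur.stabilityMatrix_negSemidef_of_lockedSolution_stable hD hφ hPs hθu hst) i j

/-- The complete network with a positive coupling constant is connected (cut form).
[cite: TaylorKuramoto2012, §4.2 («any network with node degrees at least ½(n−1) must be connected», arXiv:1109.4451 p0012)] -/
theorem complete_couplingConnected (hk : 0 < k) (hP : ∀ i j, Kur.P i j = if i = j then 0 else k) :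
    ClassicalModel.CouplingConnected Kur.P := by
  intro S hS hSc
  obtain ⟨i, hi⟩ := hS
  obtain ⟨j, hj⟩ := hSc
  refine ⟨i, hi, j, hj, ?_⟩
  have hij : i ≠ j := fun h => (Finset.mem_compl.1 hj) (h ▸ hi)
  rw [hP, if_neg hij]
  exact hk

/-- **Exponential stability modulo rotation ⇒ Lyapunov stability of the locked solution** (generic
plumbing for the first-order model, `Dᵢ > 0`): from `‖θ(t) − (θ* + c𝟙 + ω_sync t𝟙)‖ ≤
k‖θ(0) − (θ* + c𝟙)‖e^{−λt}` for `‖θ(0) − θ*‖ < ρ`, `c = ΣDᵢ(θᵢ(0) − θ*ᵢ)/ΣDᵢ` (so `|c| ≤ ‖θ(0) −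
θ*‖`), every motion from the `min(ρ, ε/(2k + 2))`-ball stays in the `ε`-tube around
`t ↦ θ* + ω_sync t𝟙`. [cite: ManikTimmeWitthaut2017, §3 Cor. 1 («transversally asymptotically stable»); Khalil2002, Theorem 4.7] -/
theorem lockedSolution_stable_of_locally_expStable (hD : ∀ i, 0 < Kur.D i) {θu : Fin n → ℝ}
    {ωs : ℝ}
    (hexp : ∃ ρ > 0, ∃ k > 0, ∃ lam > 0, ∀ (θ : ℝ → Fin n → ℝ) (T : ℝ),
      (∀ t ∈ Icc 0 T, HasDerivWithinAt θ (Kur.field (θ t)) (Icc 0 T) t) → ‖θ 0 - θu‖ < ρ →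
      ∀ t ∈ Icc 0 T,
        ‖θ t - fun i => θu i + Kur.D ⬝ᵥ (θ 0 - θu) / (∑ i, Kur.D i) + ωs * t‖
          ≤ k * ‖θ 0 - fun i => θu i + Kur.D ⬝ᵥ (θ 0 - θu) / ∑ i, Kur.D i‖ * Real.exp (-lam * t)) :
    ∀ ε > 0, ∃ δ > 0, ∀ x₁ : Fin n → ℝ, ‖x₁ - θu‖ < δ → ∀ θ : ℝ → Fin n → ℝ,
      θ 0 = x₁ → (∀ T : ℝ, ∀ t ∈ Icc 0 T, HasDerivWithinAt θ (Kur.field (θ t)) (Icc 0 T) t) →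
      ∀ t, 0 ≤ t → ‖θ t - fun i => θu i + ωs * t‖ < ε := by
  obtain ⟨ρ, hρ, k, hk, lam, hlam, hexp⟩ := hexp
  intro ε hε
  refine ⟨min ρ (ε / (2 * k + 2)), lt_min hρ (by positivity), fun x₁ hx₁ θ hθ0 hθ t ht => ?_⟩
  have hx₁ρ : ‖x₁ - θu‖ < ρ := lt_of_lt_of_le hx₁ (min_le_left _ _)
  have hx₁ε : ‖x₁ - θu‖ < ε / (2 * k + 2) := lt_of_lt_of_le hx₁ (min_le_right _ _)
  rw [← hθ0] at hx₁ρ hx₁ε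
  have hb := hexp θ t (hθ t) hx₁ρ t ⟨ht, le_rfl⟩
  set c : ℝ := Kur.D ⬝ᵥ (θ 0 - θu) / ∑ i, Kur.D i with hc
  have hn : ∀ _m : Fin n, 0 < n := fun m => Fin.pos m
  have hcle : |c| ≤ ‖θ 0 - θu‖ := by
    rcases Nat.eq_zero_or_pos n with h0 | hpos
    · subst h0
      have : c = 0 := by rw [hc]; simp
      rw [this, abs_zero]; exact norm_nonneg _
    · haveI : Nonempty (Fin n) := ⟨⟨0, hpos⟩⟩
      have hDsum : 0 < ∑ i, Kur.D i := Finset.sum_pos (fun i _ => hD i) Finset.univ_nonempty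
      rw [hc, abs_div, abs_of_pos hDsum, div_le_iff₀ hDsum]
      calc |Kur.D ⬝ᵥ (θ 0 - θu)| = |∑ i, Kur.D i * (θ 0 - θu) i| := by rfl
        _ ≤ ∑ i, |Kur.D i * (θ 0 - θu) i| := Finset.abs_sum_le_sum_abs _ _
        _ ≤ ∑ i, Kur.D i * ‖θ 0 - θu‖ := Finset.sum_le_sum fun i _ => by
            rw [abs_mul, abs_of_pos (hD i)]
            exact mul_le_mul_of_nonneg_left
              (by rw [← Real.norm_eq_abs]; exact norm_le_pi_norm _ i) (hD i).le
        _ = ‖θ 0 - θu‖ * ∑ i, Kur.D i := by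
            rw [Finset.mul_sum]; exact Finset.sum_congr rfl fun i _ => by ring
  have _ := hn
  have hconst : ‖(fun _ : Fin n => c)‖ = |c| := by
    rcases Nat.eq_zero_or_pos n with h0 | hpos
    · subst h0
      have hc0 : c = 0 := by rw [hc]; simp
      rw [hc0, abs_zero]
      exact norm_eq_zero.2 (funext fun m => m.elim0)
    · haveI : Nonempty (Fin n) := ⟨⟨0, hpos⟩⟩
      rw [pi_norm_const, Real.norm_eq_abs]
  have e1 : (θ t - fun i => θu i + ωs * t) = (θ t - fun i => θu i + c + ωs * t) + fun _ => c := by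
    funext i; simp only [Pi.sub_apply, Pi.add_apply]; ring
  have e2 : (θ 0 - fun i => θu i + c) = (θ 0 - θu) - fun _ => c := by
    funext i; simp only [Pi.sub_apply]; ring
  have h1 : ‖θ t - fun i => θu i + ωs * t‖ ≤ ‖θ t - fun i => θu i + c + ωs * t‖ + |c| := by
    rw [e1, ← hconst]
    exact norm_add_le _ _
  have h2 : ‖θ 0 - fun i => θu i + c‖ ≤ ‖θ 0 - θu‖ + |c| := by
    rw [e2, ← hconst]
    exact norm_sub_le _ _
  have hexp1 : Real.exp (-lam * t) ≤ 1 := by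
    rw [Real.exp_le_one_iff]
    nlinarith
  have h3 : ‖θ t - fun i => θu i + c + ωs * t‖ ≤ k * (‖θ 0 - θu‖ + |c|) := by
    refine hb.trans ?_
    calc k * ‖θ 0 - fun i => θu i + c‖ * Real.exp (-lam * t)
        ≤ k * ‖θ 0 - fun i => θu i + c‖ * 1 := by
          apply mul_le_mul_of_nonneg_left hexp1; positivity
      _ ≤ k * (‖θ 0 - θu‖ + |c|) := by rw [mul_one]; exact mul_le_mul_of_nonneg_left h2 hk.le
  have h4 : ‖θ t - fun i => θu i + ωs * t‖ ≤ (2 * k + 1) * ‖θ 0 - θu‖ := by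
    nlinarith [norm_nonneg (θ 0 - θu)]
  have h5 : (2 * k + 2) * ‖θ 0 - θu‖ < ε := by
    have := mul_lt_mul_of_pos_left hx₁ε (by positivity : (0 : ℝ) < 2 * k + 2)
    rwa [mul_div_cancel₀ _ (by positivity : (2 : ℝ) * k + 2 ≠ 0)] at this
  nlinarith [norm_nonneg (θ 0 - θu)]

/-- ★★★ **THEOREM 4.1 AS A DICHOTOMY: on the complete homogeneous network a phase-locked state is
LYAPUNOV STABLE ⇔ it is the IN-PHASE state** (`Pᵢⱼ = k > 0` off the diagonal, `φ = 0`, `ωᵢ = Dᵢc`,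
any `Dᵢ > 0`; «stable» = the locked solution `t ↦ θ + ω_sync t𝟙` is Lyapunov stable: every motion
from every `δ`-close phase vector stays `ε`-close for all `t ≥ 0`; motions exist from every phase
vector, `exists_globalSolution`). (⇒) Theorem 4.1 via Lemma 1's necessity; (⇐) «It is well known that
the zero fixed point is stable»: the in-phase state is in normal operation on a connected network,
hence locally exponentially stable modulo rotation (gridfusion-lit-2 / MTW Cor. 1:
`lockedSolution_locally_expStable_of_normalOperation`).
[cite: TaylorKuramoto2012, §4.1 Theorem 4.1 and «It is well known that the zero fixed point is stable» (arXiv:1109.4451 p0011–p0012); ManikTimmeWitthaut2017, §3 Lemma 1 and Cor. 1; Khalil2002, Theorem 4.7] -/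
theorem complete_lockedSolution_stable_iff_inPhase (hD : ∀ i, 0 < Kur.D i) (hk : 0 < k)
    (hP : ∀ i j, Kur.P i j = if i = j then 0 else k) (hω : ∀ i, Kur.ω i = Kur.D i * c)
    (hφ : ∀ i j, Kur.φ i j = 0) {θu : Fin n → ℝ}
    (hθu : ∀ i, Kur.field θu i = (∑ j, Kur.ω j) / ∑ j, Kur.D j) :
    (∀ ε > 0, ∃ δ > 0, ∀ x₁ : Fin n → ℝ, ‖x₁ - θu‖ < δ → ∀ θ : ℝ → Fin n → ℝ,
      θ 0 = x₁ → (∀ T : ℝ, ∀ t ∈ Icc 0 T, HasDerivWithinAt θ (Kur.field (θ t)) (Icc 0 T) t) →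
      ∀ t, 0 ≤ t → ‖θ t - fun i => θu i + (∑ j, Kur.ω j) / (∑ j, Kur.D j) * t‖ < ε)
    ↔ ∀ i j, Real.cos (θu i - θu j) = 1 := by
  constructor
  · intro hst i j
    exact Kur.complete_cos_eq_one_of_lockedSolution_stable k c hD hk hP hω hφ hθu hst i j
  · intro hin
    have hPs : ∀ i j, Kur.P i j = Kur.P j i := by
      intro i j
      rw [hP, hP]
      by_cases h : i = j
      · subst h; rfl
      · rw [if_neg h, if_neg (Ne.symm h)]
    have hP0 : ∀ i j, i ≠ j → 0 ≤ Kur.P i j := by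
      intro i j hij; rw [hP, if_neg hij]; exact hk.le
    have hexp := Kur.lockedSolution_locally_expStable_of_normalOperation hD hφ hPs hP0
      (Kur.complete_couplingConnected k hk hP) hθu (fun i j _ _ => by rw [hin i j]; exact one_pos)
    exact Kur.lockedSolution_stable_of_locally_expStable hD hexp

/-- ★★ **The same for the tree's classic all-to-all Kuramoto model `θ̇ᵢ = ω₀ − (K/n)Σⱼ sin(θᵢ − θⱼ)`**
(`classic n K (fun _ => ω₀)`: `Dᵢ = 1`, `Pᵢⱼ = K/n`, identical natural frequencies `ω₀`, `K > 0`,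
`n ≥ 1`): a phase-locked state (`θ̇ᵢ = ω₀` at every node) is Lyapunov stable iff it is in phase.
[cite: TaylorKuramoto2012, §4.1 Theorem 4.1 (arXiv:1109.4451 p0011); DorflerBullo2012, arXiv:0910.5673 §2.1 eq. (Kuramoto system)] -/
theorem classic_lockedSolution_stable_iff_inPhase {Kc ω₀ : ℝ} (hKc : 0 < Kc) (hn : 0 < n)
    {θu : Fin n → ℝ}
    (hθu : ∀ i, (classic n Kc (fun _ => ω₀)).field θu i
      = (∑ j, (classic n Kc (fun _ => ω₀)).ω j) / ∑ j, (classic n Kc (fun _ => ω₀)).D j) :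
    (∀ ε > 0, ∃ δ > 0, ∀ x₁ : Fin n → ℝ, ‖x₁ - θu‖ < δ → ∀ θ : ℝ → Fin n → ℝ,
      θ 0 = x₁ → (∀ T : ℝ, ∀ t ∈ Icc 0 T,
        HasDerivWithinAt θ ((classic n Kc (fun _ => ω₀)).field (θ t)) (Icc 0 T) t) →
      ∀ t, 0 ≤ t → ‖θ t - fun i => θu i
        + (∑ j, (classic n Kc (fun _ => ω₀)).ω j) / (∑ j, (classic n Kc (fun _ => ω₀)).D j) * t‖ < ε)
    ↔ ∀ i j, Real.cos (θu i - θu j) = 1 := by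
  have hn' : (0 : ℝ) < n := by exact_mod_cast hn
  exact (classic n Kc (fun _ => ω₀)).complete_lockedSolution_stable_iff_inPhase (Kc / n) ω₀
    (fun _ => one_pos) (div_pos hKc hn') (fun _ _ => rfl) (fun _ => by simp [classic])
    (fun _ _ => rfl) hθu

end NonuniformKuramoto

/-! ### §2. The swing twin: complete uniform coupling, zero injections -/

namespace ClassicalModel

namespace LosslessSystem

variable {n : ℕ} (S : LosslessSystem n 0) (k : ℝ)

/-- On the unloaded complete network a synchronous state (`flowᵢ(θ) = 0`) solves `Σⱼ sin(θᵢ − θⱼ) = 0`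
at every machine, and is a rest point of the damped swing model. [cite: TaylorKuramoto2012, §3 eq. (3.2) (arXiv:1109.4451 p0009); ManikTimmeWitthaut2017, §3 («Both models have the same fixed points»)] -/
theorem complete_sum_sin_eq_zero_of_flow_eq_zero (hk : k ≠ 0)
    (hC : ∀ i j, S.C i j = if i = j then 0 else k) {θ : Fin n → ℝ} (hflow : ∀ i, S.flow θ i = 0)
    (m : Fin n) : ∑ j, Real.sin (θ m - θ j) = 0 := by
  have h := hflow m
  have hsum : S.flow θ m = k * ∑ j, Real.sin (θ m - θ j) := by
    simp only [flow, Finset.univ_eq_empty, Finset.sum_empty, add_zero]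
    rw [Finset.mul_sum]
    refine Finset.sum_congr rfl fun j _ => ?_
    rw [hC]
    by_cases hmj : m = j
    · subst hmj; simp
    · rw [if_neg hmj]
  rw [hsum] at h
  rcases mul_eq_zero.1 h with h3 | h3
  · exact absurd h3 hk
  · exact h3

/-- ★★ **Theorem 4.1 for the damped swing model: a Lyapunov-STABLE synchronous state of the unloaded
complete uniformly coupled network is IN PHASE** (`Cᵢⱼ = k > 0` for `i ≠ j`, `P = 0`,
`Mᵢ, Dᵢ > 0`; `flow(θ) = 0`; «stable» = every motion from every state `δ`-close to the rest point
`(θ, 0)` stays `ε`-close, motions existing by `exists_globalSolution`): `cos(θᵢ − θⱼ) = 1` for all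
`i, j` (a stable rest point has non-negative cuts, `cut_nonneg_of_stable` = Taylor's Lemma 2.1 for the
swing model, then the geometric core).
[cite: TaylorKuramoto2012, §4.1 Theorem 4.1 (arXiv:1109.4451 p0011–p0012); ManikTimmeWitthaut2017, §3 Lemma 1 («for both the Kuramoto system and the power grid model»); Khalil2002, Theorem 4.7 (part 2)] -/
theorem complete_cos_eq_one_of_stable (hk : 0 < k) (hC : ∀ i j, S.C i j = if i = j then 0 else k)
    (hP : ∀ i, S.P i = 0) (hM : ∀ i, 0 < S.M i) (hD : ∀ i, 0 < S.D i) {θe : Fin n → ℝ}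
    (hflow : ∀ i, S.flow θe i = 0)
    (hst : ∀ ε > 0, ∃ δ > 0, ∀ x₁ : (Fin n → ℝ) × (Fin n → ℝ), dist x₁ (θe, 0) < δ →
      ∀ X : ℝ → (Fin n → ℝ) × (Fin n → ℝ), X 0 = x₁ →
        (∀ T : ℝ, ∀ t ∈ Icc 0 T, HasDerivWithinAt X (S.field (X t)) (Icc 0 T) t) →
        ∀ t, 0 ≤ t → dist (X t) (θe, 0) < ε)
    (i j : Fin n) : Real.cos (θe i - θe j) = 1 := by
  have hCs : ∀ i j, S.C i j = S.C j i := by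
    intro i j
    rw [hC, hC]
    by_cases h : i = j
    · subst h; rfl
    · rw [if_neg h, if_neg (Ne.symm h)]
  have he : S.IsEquilibrium θe := fun i => by rw [hP i, hflow i]
  refine cos_sub_eq_one_of_sum_sin_eq_zero_of_cuts_nonneg θe
    (S.complete_sum_sin_eq_zero_of_flow_eq_zero k hk.ne' hC hflow) (fun A => ?_) i j
  have h := S.cut_nonneg_of_stable hCs hM hD he hst A
  simp only [Finset.univ_eq_empty, Finset.sum_empty, Finset.sum_const_zero, add_zero] at h
  have hcut : ∑ i ∈ A, ∑ j ∈ Aᶜ, S.C i j * Real.cos (θe i - θe j)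
      = k * ∑ i ∈ A, ∑ j ∈ Aᶜ, Real.cos (θe i - θe j) := by
    rw [Finset.mul_sum]
    refine Finset.sum_congr rfl fun i hi => ?_
    rw [Finset.mul_sum]
    refine Finset.sum_congr rfl fun j hj => ?_
    have hij : i ≠ j := fun h => (Finset.mem_compl.1 hj) (h ▸ hi)
    rw [hC, if_neg hij]
  rw [hcut] at h
  exact (mul_nonneg_iff_of_pos_left hk).1 h

/-- ★★★ **THE SWING DICHOTOMY: on the unloaded complete uniformly coupled network a synchronous state
is a LYAPUNOV-STABLE rest point ⇔ it is IN PHASE** (`Cᵢⱼ = k > 0` off the diagonal, `P = 0`,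
`Mᵢ, Dᵢ > 0`, `flow(θ) = 0`; stable = for every `ε > 0` some `δ > 0` such that every `δ`-close state
HAS a forward-global motion and ALL its motions stay `ε`-close to `(θ, 0)`). (⇐) is MTW Cor. 1 for the
motions (`stable_syncSolution_of_normalOperation`, energy route; the complete network is connected).
[cite: TaylorKuramoto2012, §4.1 Theorem 4.1 (arXiv:1109.4451 p0011–p0012); ManikTimmeWitthaut2017, §3 Lemma 1 and Cor. 1 («normal operation … for both models»); Khalil2002, Theorem 4.7] -/
theorem complete_stable_iff_inPhase (hk : 0 < k) (hC : ∀ i j, S.C i j = if i = j then 0 else k)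
    (hP : ∀ i, S.P i = 0) (hM : ∀ i, 0 < S.M i) (hD : ∀ i, 0 < S.D i) {θe : Fin n → ℝ}
    (hflow : ∀ i, S.flow θe i = 0) :
    (∀ ε > 0, ∃ δ > 0, ∀ x₁ : (Fin n → ℝ) × (Fin n → ℝ), dist x₁ (θe, 0) < δ →
      (∃ X : ℝ → (Fin n → ℝ) × (Fin n → ℝ), X 0 = x₁ ∧
          ∀ T : ℝ, ∀ t ∈ Icc 0 T, HasDerivWithinAt X (S.field (X t)) (Icc 0 T) t) ∧
        ∀ X : ℝ → (Fin n → ℝ) × (Fin n → ℝ), X 0 = x₁ →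
          (∀ T : ℝ, ∀ t ∈ Icc 0 T, HasDerivWithinAt X (S.field (X t)) (Icc 0 T) t) →
          ∀ t, 0 ≤ t → dist (X t) (θe, 0) < ε)
    ↔ ∀ i j, Real.cos (θe i - θe j) = 1 := by
  have hCs : ∀ i j, S.C i j = S.C j i := by
    intro i j
    rw [hC, hC]
    by_cases h : i = j
    · subst h; rfl
    · rw [if_neg h, if_neg (Ne.symm h)]
  constructor
  · intro hst i j
    refine S.complete_cos_eq_one_of_stable k hk hC hP hM hD hflow (fun ε hε => ?_) i j
    obtain ⟨δ, hδ, h⟩ := hst ε hε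
    exact ⟨δ, hδ, fun x₁ hx₁ X hX0 hX => (h x₁ hx₁).2 X hX0 hX⟩
  · intro hin ε hε
    have hC0 : ∀ i j, i ≠ j → 0 ≤ S.C i j := by
      intro i j hij; rw [hC, if_neg hij]; exact hk.le
    have hconn : CouplingConnected S.C := by
      intro A hA hAc
      obtain ⟨i, hi⟩ := hA
      obtain ⟨j, hj⟩ := hAc
      refine ⟨i, hi, j, hj, ?_⟩
      have hij : i ≠ j := fun h => (Finset.mem_compl.1 hj) (h ▸ hi)
      rw [hC, if_neg hij]
      exact hk
    have hPsum : (∑ j, S.P j) / (∑ j, S.D j) = 0 := by simp [hP]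
    have hsync : ∀ i, S.P i - S.D i * ((∑ j, S.P j) / ∑ j, S.D j) = S.flow θe i := by
      intro i
      rw [hPsum, hP i, hflow i]
      ring
    have h := S.stable_syncSolution_of_normalOperation hCs hC0 hconn hM hD hsync
      (fun i j _ _ => by rw [hin i j]; exact one_pos) hε
    simp only [hPsum, zero_mul, sub_zero, Prod.mk.eta] at h
    obtain ⟨δ, hδ, hst⟩ := h
    refine ⟨δ, hδ, fun x₁ hx₁ => ?_⟩
    have hx₁' : dist x₁ (θe, fun _ : Fin n => (0 : ℝ)) < δ := hx₁
    obtain ⟨hex, hall⟩ := hst x₁ hx₁'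
    exact ⟨hex, fun X hX0 hX t ht => ((hall X hX0 hX).1 t ht)⟩

end LosslessSystem

end ClassicalModel

end Literature.MathematicalPhysics.PowerSystems

end
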